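import Mathlib
import Literature.AlgebraicGeometry.Resolution.ResolutionOfSingularities
import Literature.AlgebraicGeometry.Resolution.ReflexiveModulesRationalDoublePoints
import Literature.AlgebraicGeometry.Resolution.PrincipalizationToResolution
import HarnessLib

/-!
# Uniqueness of the minimal resolution (universal-property form) up to a unique isomorphism over the base

For the tree's `IsMinimalResolution π` («`π` is a resolution and EVERY resolution of the same base factors through
`π`», `ReflexiveModulesRationalDoublePoints.lean`; Lipman 1969 Thm. (4.1) / Bădescu Prop. 4.5 phrase minimality
this way) we prove the folklore rigidity statements that make «the» minimal resolution well defined: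

* `IsResolution.eq_id_of_comp_eq` — a resolution has NO non-trivial endomorphism over its base: if `π : X ⟶ S` is a
  resolution (proper, birational in the tree's sense: an isomorphism over a dense open `U ⊆ S` with dense preimage,
  regular source) and `f : X ⟶ X` satisfies `f ≫ π = π`, then `f = 𝟙 X`.  Proof: on the dense open `V = π⁻¹(U)` the
  morphism `f` restricts to an endomorphism of `V` over `U ≅ V`, hence to the identity; two morphisms from the reduced
  `X` to the `S`-separated `X` agreeing on a dominant open immersion agree (Mathlib `ext_of_isDominant_of_isSeparated`).
* `IsResolution.eq_of_comp_eq` — more generally two `S`-morphisms `f g : Y ⟶ X` INTO a resolution that agree after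
  `π` need not agree; what we prove and use is the endomorphism case and:
* `IsMinimalResolution.nonempty_iso` — two minimal resolutions `π₁ : X₁ ⟶ S`, `π₂ : X₂ ⟶ S` of the same base are
  isomorphic OVER `S` (`∃ e : X₁ ≅ X₂, e.hom ≫ π₂ = π₁`); `IsMinimalResolution.isIso_of_comp_eq` — ANY `S`-morphism
  between two minimal resolutions is an isomorphism.

Use (cell res-hironaka, crux chain W4.4, `[OURS · L W4.4]`): brick G0 of the (L1-w) sandwich step `stub_L1wCore` of the
crux `HomologicalConductor.NoZenoR` (the split count `N^s` and the sep-node blow-up are read on «the» minimal resolution: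
`HasSplitExcCurveCountLE` and `IsSepX1Sandwiched` each quantify over SOME minimal resolution) and of the kill test
`SurfaceTermination` (stmt-ResolutionOfSingularities-16488).  AI-written, weaker than expert review.

[cite: Lipman1969, Theorem (4.1) (p. 208)]
-/

noncomputable section

open CategoryTheory AlgebraicGeometry TopologicalSpace

universe u

namespace Literature.AlgebraicGeometry.Resolution

namespace IsResolution

variable {X S : Scheme.{u}} {π : X ⟶ S}

/-- **A resolution has no non-trivial endomorphism over its base**: `f ≫ π = π ⇒ f = 𝟙 X`.
[cite: Lipman1969, Theorem (4.1) (p. 208)] [folklore] -/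
theorem eq_id_of_comp_eq (hπ : IsResolution π) (f : X ⟶ X) (hf : f ≫ π = π) : f = 𝟙 X := by
  haveI : IsProper π := hπ.isProper
  haveI : IsReduced X := hπ.isRegular.isReduced
  obtain ⟨U, _hUdense, hVdense, hiso⟩ := hπ.isBirational
  haveI := hiso
  -- the dense open `V = π⁻¹(U)` and its (dominant) inclusion
  set V : X.Opens := π ⁻¹ᵁ U with hV
  haveI : IsDominant V.ι := AlgebraicGeometry.Opens.isDominant_ι hVdense
  -- `f` maps `V` into `V` (it is a morphism over `S` and `V` is a preimage)
  have hrange : Set.range (V.ι ≫ f).base ⊆ Set.range V.ι.base := by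
    rintro _ ⟨v, rfl⟩
    have hv : (π.base (f.base (V.ι.base v))) ∈ (U : Set S) := by
      have h1 : π.base (f.base (V.ι.base v)) = π.base (V.ι.base v) := by
        change ((V.ι ≫ f) ≫ π).base v = (V.ι ≫ π).base v
        rw [Category.assoc, hf]
      rw [h1]
      exact v.2
    exact ⟨⟨f.base (V.ι.base v), hv⟩, rfl⟩
  -- the lift `l : V ⟶ V` of `V.ι ≫ f` through `V.ι`
  let l : (V : Scheme.{u}) ⟶ V := IsOpenImmersion.lift V.ι (V.ι ≫ f) hrange
  have hl : l ≫ V.ι = V.ι ≫ f := IsOpenImmersion.lift_fac _ _ _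
  -- `l` is an endomorphism of `V` over `U`, and `π ∣_ U : V ⟶ U` is an isomorphism, so `l = 𝟙`
  have hlU : l ≫ (π ∣_ U) = π ∣_ U := by
    have h1 : (l ≫ (π ∣_ U)) ≫ U.ι = (π ∣_ U) ≫ U.ι := by
      rw [Category.assoc, morphismRestrict_ι, ← Category.assoc, hl, Category.assoc, hf]
    exact (cancel_mono U.ι).mp h1
  have hl1 : l = 𝟙 _ := by
    rw [← cancel_mono (π ∣_ U), hlU, Category.id_comp]
  have hVf : V.ι ≫ f = V.ι ≫ 𝟙 X := by
    rw [← hl, hl1, Category.id_comp, Category.comp_id]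
  exact ext_of_isDominant_of_isSeparated π (by rw [hf, Category.id_comp]) V.ι hVf

end IsResolution

namespace IsMinimalResolution

variable {X₁ X₂ S : Scheme.{u}} {π₁ : X₁ ⟶ S} {π₂ : X₂ ⟶ S}

/-- **Any `S`-morphism between two minimal resolutions is an isomorphism.**
[cite: Lipman1969, Theorem (4.1) (p. 208)] [folklore] -/
theorem isIso_of_comp_eq (h₁ : IsMinimalResolution π₁) (h₂ : IsMinimalResolution π₂) (g : X₁ ⟶ X₂)
    (hg : g ≫ π₂ = π₁) : IsIso g := by
  obtain ⟨h, hh⟩ := h₁.2 X₂ π₂ h₂.isResolution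
  have hgh : g ≫ h = 𝟙 X₁ :=
    h₁.isResolution.eq_id_of_comp_eq (g ≫ h) (by rw [Category.assoc, hh, hg])
  have hhg : h ≫ g = 𝟙 X₂ :=
    h₂.isResolution.eq_id_of_comp_eq (h ≫ g) (by rw [Category.assoc, hg, hh])
  exact ⟨h, hgh, hhg⟩

/-- **Two minimal resolutions of the same base are isomorphic over the base.**
[cite: Lipman1969, Theorem (4.1) (p. 208)] [folklore] -/
theorem nonempty_iso (h₁ : IsMinimalResolution π₁) (h₂ : IsMinimalResolution π₂) :
    ∃ e : X₁ ≅ X₂, e.hom ≫ π₂ = π₁ := by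
  obtain ⟨g, hg⟩ := h₂.2 X₁ π₁ h₁.isResolution
  haveI : IsIso g := isIso_of_comp_eq h₁ h₂ g hg
  exact ⟨asIso g, hg⟩

/-- Two minimal resolutions are isomorphic over the base, with the isomorphism commuting BOTH ways
(`e.hom ≫ π₂ = π₁` and `e.inv ≫ π₁ = π₂`). [cite: Lipman1969, Theorem (4.1) (p. 208)] -/
theorem nonempty_iso' (h₁ : IsMinimalResolution π₁) (h₂ : IsMinimalResolution π₂) :
    ∃ e : X₁ ≅ X₂, e.hom ≫ π₂ = π₁ ∧ e.inv ≫ π₁ = π₂ := by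
  obtain ⟨e, he⟩ := nonempty_iso h₁ h₂
  refine ⟨e, he, ?_⟩
  rw [← he, Iso.inv_hom_id_assoc]

end IsMinimalResolution

/-- **Morphisms over the base between two minimal resolutions coincide** (so the isomorphism of
`IsMinimalResolution.nonempty_iso` is UNIQUE): compose with the inverse of one isomorphism over the base and apply
`IsResolution.eq_id_of_comp_eq`. (Re-appended: this declaration of p531855 was dropped by the whole-file landing
p532206; cell res-hironaka, chain W4.4, consumer `stub_L1wCore` count bookkeeping.) [cite: Badescu2001, Prop. 4.5] -/
theorem IsMinimalResolution.hom_ext {X₁ X₂ S : Scheme.{u}} {π₁ : X₁ ⟶ S} {π₂ : X₂ ⟶ S}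
    (h₁ : IsMinimalResolution π₁) (h₂ : IsMinimalResolution π₂) {a b : X₁ ⟶ X₂}
    (ha : a ≫ π₂ = π₁) (hb : b ≫ π₂ = π₁) : a = b := by
  obtain ⟨e, he⟩ := h₁.nonempty_iso h₂
  have hinv : e.inv ≫ π₁ = π₂ := by rw [← he, e.inv_hom_id_assoc]
  have h1 : a ≫ e.inv = 𝟙 X₁ :=
    h₁.isResolution.eq_id_of_comp_eq (a ≫ e.inv) (by rw [Category.assoc, hinv, ha])
  have h2 : b ≫ e.inv = 𝟙 X₁ :=
    h₁.isResolution.eq_id_of_comp_eq (b ≫ e.inv) (by rw [Category.assoc, hinv, hb])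
  calc a = (a ≫ e.inv) ≫ e.hom := by rw [Category.assoc, e.inv_hom_id, Category.comp_id]
    _ = (b ≫ e.inv) ≫ e.hom := by rw [h1, h2]
    _ = b := by rw [Category.assoc, e.inv_hom_id, Category.comp_id]

end Literature.AlgebraicGeometry.Resolution

end
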